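import Mathlib
import Literature.NumberTheory.Transcendental.KZCubicalCalculus
import Summits.KontsevichZagierPeriods.KontsevichZagierPeriods.Theorems.InverseLandauTateFamilyKernelStubGlueProduct

/-!
# Crux `TateFamilyKernel` (stmt-KontsevichZagierPeriods-9130), line `Sketch` — stub `stub_productIntegral`

Fubini for a placement.  For a relabelling `e : Fin (d + c) ≃ Fin M` of the coordinates of the
cube `[0,1]^M` into a first block `I = e ∘ Fin.castAdd c` of `d` coordinates and a second block
`J = e ∘ Fin.natAdd d` of `c` coordinates, and arbitrary functions `u` on `ℝ^d`, `g` on `ℝ^c`,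

  `∫_{[0,1]^M} u (w_I) · g (w_J) dw = (∫_{[0,1]^d} u) · (∫_{[0,1]^c} g)`.

No integrability hypotheses are needed (`MeasureTheory.setIntegral_prod_mul` is unconditional,
both sides vanishing in the non-integrable cases).

Proof.  The measurable equivalence `Φ : ℝ^d × ℝ^c ≃ᵐ ℝ^M`, `Φ (x, y) = (Fin.append x y) ∘ e⁻¹`
(the tree's `KZ.appendMeasurableEquiv d c` followed by Mathlib's coordinate relabelling
`MeasurableEquiv.piCongrLeft _ e`) preserves Lebesgue measure, reads `x` on the block `I` and `y`
on the block `J`, and pulls `[0,1]^M` back to `[0,1]^d ×ˢ [0,1]^c`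
(`mem_cube_iff_comp_equiv`); transport the integral along `Φ`
(`MeasurePreserving.setIntegral_preimage_emb`) and apply Fubini on the product of cubes.
-/

noncomputable section

open MeasureTheory Set
open Literature.NumberTheory.Transcendental

namespace Summit.KontsevichZagierPeriods.InverseLandau.TateFamilyKernel.Descent

/-- The relabelled append map `Φ : ℝ^d × ℝ^c ≃ᵐ ℝ^M`, `Φ p = (Fin.append p.1 p.2) ∘ e⁻¹`, read at
the coordinate `e k` is `Fin.append p.1 p.2 k`. [folklore] -/
theorem appendMeasurableEquiv_trans_piCongrLeft_apply {d c M : ℕ} (e : Fin (d + c) ≃ Fin M)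
    (p : (Fin d → ℝ) × (Fin c → ℝ)) (k : Fin (d + c)) :
    ((KZ.appendMeasurableEquiv d c).trans (MeasurableEquiv.piCongrLeft (fun _ : Fin M => ℝ) e))
        p (e k) = Fin.append p.1 p.2 k := by
  rw [MeasurableEquiv.coe_trans, Function.comp_apply, MeasurableEquiv.piCongrLeft_apply_apply,
    KZ.appendMeasurableEquiv_apply]

/-- The relabelled append map `Φ : ℝ^d × ℝ^c ≃ᵐ ℝ^M` pulls the cube `[0,1]^M` back to the
product of cubes `[0,1]^d ×ˢ [0,1]^c`. [folklore] -/
theorem preimage_appendMeasurableEquiv_trans_piCongrLeft_cube {d c M : ℕ}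
    (e : Fin (d + c) ≃ Fin M) :
    (KZ.appendMeasurableEquiv d c).trans (MeasurableEquiv.piCongrLeft (fun _ : Fin M => ℝ) e) ⁻¹'
        KZ.cube M = KZ.cube d ×ˢ KZ.cube c := by
  ext p
  rw [Set.mem_preimage, mem_cube_iff_comp_equiv e, Set.mem_prod]
  simp only [appendMeasurableEquiv_trans_piCongrLeft_apply, Fin.append_left, Fin.append_right]

/-- **Fubini for a placement** (stub `stub_productIntegral` of the skeleton of crux
`TateFamilyKernel`).  For a placement `e : Fin (d + c) ≃ Fin M` of `d + c` coordinates, the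
integral over `[0,1]^M` of `u (w_I) · g (w_J)` (`I = e ∘ castAdd c`, `J = e ∘ natAdd d`) is the
product of the integrals of `u` over `[0,1]^d` and of `g` over `[0,1]^c`, for arbitrary `u`, `g`
(change of variables along the volume-preserving `ℝ^d × ℝ^c ≃ᵐ ℝ^M` and Fubini–Tonelli on the
product of cubes; no integrability hypotheses). [folklore] -/
theorem stub_productIntegral {d c M : ℕ} (e : Fin (d + c) ≃ Fin M)
    (u : (Fin d → ℝ) → ℝ) (g : (Fin c → ℝ) → ℝ) :
    ∫ w in KZ.cube M, u (fun t => w (e (Fin.castAdd c t))) * g (fun t => w (e (Fin.natAdd d t))) =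
      (∫ x in KZ.cube d, u x) * ∫ y in KZ.cube c, g y := by
  have hΦ : MeasurePreserving
      ((KZ.appendMeasurableEquiv d c).trans (MeasurableEquiv.piCongrLeft (fun _ : Fin M => ℝ) e))
      volume volume :=
    KZ.volume_preserving_appendMeasurableEquiv.trans
      (volume_measurePreserving_piCongrLeft (fun _ : Fin M => ℝ) e)
  rw [← hΦ.setIntegral_preimage_emb (MeasurableEquiv.measurableEmbedding _),
    preimage_appendMeasurableEquiv_trans_piCongrLeft_cube]
  simp only [appendMeasurableEquiv_trans_piCongrLeft_apply, Fin.append_left, Fin.append_right]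
  rw [Measure.volume_eq_prod, setIntegral_prod_mul]

end Summit.KontsevichZagierPeriods.InverseLandau.TateFamilyKernel.Descent
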